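import Summits.BirchSwinnertonDyer.Rank1Residual.Additive.QuadraticBaseChangeTamagawaCanonicalModel
import Summits.BirchSwinnertonDyer.Rank1Residual.AdditivePotMult.QuadraticTorsionValuation
import Literature.NumberTheory.EllipticCurves.BSDQuadraticDescentTorsionOddPartProofs
import Literature.NumberTheory.EllipticCurves.BSDQuadraticDescentShaOddPartGeneralProofs
import Literature.NumberTheory.EllipticCurves.HeegnerPointsKolyvaginExceptionalTwistProofs
import HarnessLib

/-!
# `Ш(V_K)` finite and the `p`-adic valuation of Milne's quotient identity on `V ⊗ K`, as THEOREMS on S₁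
# (cell `b2b-bsdres`, team n1011, seat p16 GEN 8; row T-MIL-CAN FILE 2 — what the `ℚ(ζ₃)`-side
# consumers read from A73 `hMilne`, proved on n1011-p01's population S₁)

HONEST FRAMING (cell `b2b-bsdres`, run/shared/lean/b2b/bsd-rank1-residual/, verbatim in every
file): the goal of the cell is to DELETE the COMBINATION-SHAPED residual classes of the
Birch–Swinnerton-Dyer formula for ALL analytic-rank `≤ 1` elliptic curves over `ℚ` — "full BSD
formula for every rank `≤ 1` curve in class `C`" assembled STRICTLY from published theorems — so
that the rank-`≤ 1` remainder becomes exactly the CONSTRUCTION-SHAPED classes, which are TYPED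
(missing-input `Prop`s), NOT attempted. This is not "finishing BSD". Team n1011 and the
`K = ℚ(ζ₃)`-side lines: research routes; X3 / X4 stay CONSTRUCTION-SHAPED; nothing is booked; no mark /
label moved. TOOL theorems only: no definition, no named fact, no `sorry`.

## What

The `ℚ(ζ₃)`-side class theorems of `Additive/` take Milne's Weil-restriction identity as the WHOLE named
fact A73 `Milne1972.bsdQuotient_baseChange_quadratic_anyModel` (`hMilne`, canonical model `V ⊗ K`,
Dokchitser–Dokchitser's `C(V⊗K)`) and READ from it exactly (i) `Ш(V_K)` finite and (ii) the `p`-adic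
valuation of the card identity — rank `(0,0)`: `CyclotomicThreeDescentData.card_identity_baseChange`,
`C(V⊗K)·#Ш(V_K)·#V(ℚ)²·#W(ℚ)² = n_V·|u_C|·#Ш(V)·#Ш(W)·∏c(V)·∏c(W)·#V(K)²`; rank one: the same with
torsion orders (`XGordRankZeroOneCyclotomicThreePrep.padicVal_card_identity_rankZeroOne`, index `m ∣ 2`
so no `m`-term at odd `p`; the transport shapes of `CyclotomicThreeRankOne[One]TwistDescentData` keep a
term `2·ord_p m`). On n1011-p01's population S₁ of row T-MIL-ODD (`V/ℚ`
globally minimal; `K` quadratic, `d_K` odd squarefree; `W = C • V^{(d_K)}` globally minimal; at every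
place `V` good, or multiplicative, or the place divides `d_K` and `W` is multiplicative there) and for an
odd `p` at which `V` is good or multiplicative, BOTH are theorems:

* `shaFinite_baseChange_of_twist` — (i) from `Ш(V)`, `Ш(W)` finite (tree `shaFinite_baseChange_of_shaFinite`,
  Dokchitser–Dokchitser Lemma 4.14; any quadratic `K`, no population hypothesis);
* `padicVal_card_identity_baseChange_of_semistable` — (ii) in rank `(0,0)`, literally
  `congrArg (padicValRat p)` of the conclusion of `card_identity_baseChange`: FILE 1's Tamagawa–unit
  identity `v_p C(V⊗K) = v_p(|u_C|·∏c(V)·∏c(W))` + the tree's odd parts of `Ш`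
  (`padicValNat_shaOrder_baseChange_quadratic_of_odd`) and of the Mordell–Weil orders
  (`padicValNat_natCard_point_baseChange_quadratic_of_odd`, Silverman Ex. 10.16);
* `padicValNat_shaOrder_baseChange_of_twist` — `v_p #Ш(V_K) = v_p #Ш(V) + v_p #Ш(W)`, odd `p`, ANY
  rank (tree `card_primaryComponent_sha_baseChange_quadratic_of_odd_of_finite`, JSW 2017 §7.4.1);
* **`padicVal_card_identity_baseChange_anyRank_of_semistable`** — (ii) in ANY rank:
  `v_p C(V⊗K) + v_p #Ш(V_K) + 2 v_p #V(ℚ)_tors + 2 v_p #W(ℚ)_tors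
     = v_p|u_C| + v_p #Ш(V) + v_p #Ш(W) + v_p ∏c(V) + v_p ∏c(W) + 2 v_p #V(K)_tors`
  (torsion part: additive-p1's `padicValNat_torsionOrder_baseChange_quadratic_anyRank`) — the second
  conjunct of `padicVal_card_identity_rankZeroOne` with `hWR` and `hm2` GONE (no Mordell–Weil basis or
  index enters on S₁); for the transport shapes (`…rankOneZero`, `…rankOneOne`) it is their `m`-free
  form, matching them needs `p ∤ m` (not proved here; those two `…LowerK` files have no consumer);
* `…_of_squarefree` (both shapes) — the same with `hS` and `h₀` discharged from the per-row certificate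
  `Squarefree (V.conductorNorm ℤ)` (FILE 1 §3).

So for ord_p-consumers in the `V ⊗ K` currency the binder switch of lead R5-74 (e) is `hMilne ↦ hS`
on S₁. HONEST LIMITS: S₁ × {`d_K` odd squarefree} × {`p` odd, `V` good or multiplicative at `p`}
only; the `2`-part, the regulators / periods and the real identity are NOT touched (Cassels–Tate /
local-index content of Milne's proof); A73 is NOT discharged (it quantifies over all data); consumer
twins are separate files; closes no class; moves no mark. References: Milne, Invent. Math. 17 (1972)
§1 Thm. 1; T. and V. Dokchitser, Ann. of Math. 172 (2010) §2.1, Lemma 4.14; Jetchev–Skinner–Wan, Camb.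
J. Math. 5 (2017) §7.4.1; Silverman, *AEC* Ex. 10.16.
-/

noncomputable section

open scoped Classical NumberField

open WeierstrassCurve NumberField IsDedekindDomain Rat.HeightOneSpectrum
  Literature.NumberTheory.EllipticCurves Literature.NumberTheory.QuadraticFields
  Summit.BirchSwinnertonDyer.Rank1Residual.AdditivePotMult

namespace Summit.BirchSwinnertonDyer.Rank1Residual.Additive

/-! ## §1 `Ш(V_K)` finite and the `p`-adic valuation of the rank-`(0,0)` card identity on S₁ -/

section CardIdentity

variable (K : Type) [Field K] [NumberField K]
  (V : WeierstrassCurve ℚ) [V.IsElliptic] [V.IsGloballyMinimal]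
  (W : WeierstrassCurve ℚ) [W.IsElliptic] [W.IsGloballyMinimal] (p : ℕ) [hp : Fact p.Prime]

/-- **`C(X) ≠ 0`** for an elliptic `X` over a number field: every local factor `c_w · N(w)^{k_w}` of
Dokchitser–Dokchitser's `C(X)` is non-zero, and a `finprod` with infinite support is `1` (light-import
form of the tree's `WeierstrassCurve.modifiedTamagawaProduct_pos`).
[cite: DokchitserDokchitserAnnals2010, §1 Notation (arXiv pp. 4–5)] -/
theorem modifiedTamagawaProduct_ne_zero {L : Type} [Field L] [NumberField L]
    (X : WeierstrassCurve L) [X.IsElliptic] : X.modifiedTamagawaProduct ≠ 0 := by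
  have hC0 : ∀ w : HeightOneSpectrum (𝓞 L), X.localTamagawaFactor w ≠ 0 := fun w ↦ by
    have hc0 : ((X.baseChange (w.adicCompletion L)).localTamagawaNumber (w.adicCompletionIntegers L) : ℚ)
        ≠ 0 := by exact_mod_cast X.localTamagawaNumber_baseChange_ne_zero w
    have hN0 : ((Ideal.absNorm w.asIdeal : ℕ) : ℚ) ≠ 0 := by
      exact_mod_cast fun h ↦ w.ne_bot (Ideal.absNorm_eq_zero_iff.mp h)
    rw [localTamagawaFactor_def]
    exact mul_ne_zero hc0 (zpow_ne_zero _ hN0)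
  rw [modifiedTamagawaProduct_def]
  by_cases hfin : (Function.mulSupport fun w ↦ X.localTamagawaFactor w).Finite
  · rw [finprod_eq_prod _ hfin]
    exact Finset.prod_ne_zero_iff.mpr fun w _ ↦ hC0 w
  · rw [finprod_of_infinite_mulSupport hfin]
    exact one_ne_zero

omit [V.IsGloballyMinimal] [W.IsElliptic] [W.IsGloballyMinimal] in
/-- **`Ш(V_K)` is finite as soon as `Ш(V)` and `Ш(W)` are** (`[K:ℚ] = 2`, `W = C • V^{(d_K)}`): the
tree's `shaFinite_baseChange_of_shaFinite` (Dokchitser–Dokchitser 2010 Lemma 4.14 / Milne 1972 Thm. 1,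
finiteness content) moved along the `ℚ`-isomorphism `W ≅ V^{(d_K)}` (`shaFinite_variableChange_iff`).
This is clause (i) of what the `ℚ(ζ₃)`-side consumers read from `hMilne`.
[cite: DokchitserDokchitserAnnals2010, Lemma 4.14 (proof)] [cite: Milne1972ArithmeticAV, §1 Thm. 1] -/
theorem shaFinite_baseChange_of_twist (h2 : Module.finrank ℚ K = 2)
    {C : VariableChange ℚ} (hC : C • V.quadraticTwist (NumberField.discr K : ℚ) = W)
    (hfinV : V.ShaFinite) (hfinW : W.ShaFinite) : (V.baseChange K).ShaFinite := by
  have hd : (NumberField.discr K : ℚ) ≠ 0 := by exact_mod_cast NumberField.discr_ne_zero K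
  haveI := V.isElliptic_quadraticTwist hd
  have hW' : (C • V.quadraticTwist (NumberField.discr K : ℚ)).ShaFinite := by rw [hC]; exact hfinW
  exact shaFinite_baseChange_of_shaFinite V K h2 hfinV
    ((shaFinite_variableChange_iff_holds (V.quadraticTwist (NumberField.discr K : ℚ)) C).mp hW')

/-- **THE `p`-ADIC VALUATION OF THE CARD IDENTITY ON S₁ (rank `(0,0)` shape; `p` odd, `V` good or
multiplicative at `p`)**: for `V/ℚ` globally minimal, `K` quadratic with `d_K` odd squarefree,
`W = C • V^{(d_K)}` globally minimal, `hS`, and `V(ℚ)`, `W(ℚ)` (hence `V(K)`), `Ш(V)`, `Ш(W)` finite,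
`v_p(C(V⊗K)·#Ш(V_K)·#V(ℚ)²·#W(ℚ)²) = v_p(n_V·|u_C|·#Ш(V)·#Ш(W)·∏c(V)·∏c(W)·#V(K)²)`
— literally `congrArg (padicValRat p)` of the conclusion of
`CyclotomicThreeDescentData.card_identity_baseChange` (there obtained from Milne's A73 `hWR`), here a
THEOREM: Tamagawa–unit part §2, `Ш` part `padicValNat_shaOrder_baseChange_quadratic_of_odd`
(Dokchitser–Dokchitser Lemma 4.14), Mordell–Weil part `padicValNat_natCard_point_baseChange_quadratic_of_odd`
(Silverman Ex. 10.16), `n_V ∈ {1,2}` a `p`-adic unit.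
[cite: Milne1972ArithmeticAV, §1 Thm. 1 and §2 (through DokchitserDokchitserAnnals2010, §2.1, proof of Thm. 8)]
[cite: DokchitserDokchitserAnnals2010, Lemma 4.14 (proof)] [cite: SilvermanAEC2009, Exercise 10.16] -/
theorem padicVal_card_identity_baseChange_of_semistable (h2 : Module.finrank ℚ K = 2)
    (hdodd : Odd (NumberField.discr K)) (hdsq : Squarefree (NumberField.discr K))
    {C : VariableChange ℚ} (hC : C • V.quadraticTwist (NumberField.discr K : ℚ) = W) (hp2 : p ≠ 2)
    (hS : ∀ v : HeightOneSpectrum (𝓞 ℚ), V.HasGoodReductionAt v ∨ V.HasMultiplicativeReductionAt v ∨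
      (((primesEquiv v : ℕ) : ℤ) ∣ NumberField.discr K ∧ W.HasMultiplicativeReductionAt v))
    (h₀ : V.HasGoodReductionAtPrime p ∨ V.HasMultiplicativeReductionAtPrime p)
    [Finite V.toAffine.Point] [Finite W.toAffine.Point] (hfinV : V.ShaFinite) (hfinW : W.ShaFinite) :
    padicValRat p ((V.baseChange K).modifiedTamagawaProduct * (V.baseChange K).shaOrder *
        (Nat.card V.toAffine.Point) ^ 2 * (Nat.card W.toAffine.Point) ^ 2 : ℚ) =
      padicValRat p ((V.baseChange ℝ).numRealComponents * |(C.u : ℚ)| * V.shaOrder * W.shaOrder *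
        V.tamagawaProduct * W.tamagawaProduct * (Nat.card (V.baseChange K).toAffine.Point) ^ 2 : ℚ) := by
  haveI : (V.baseChange K).IsElliptic := by rw [baseChange]; infer_instance
  haveI : Finite (V.baseChange K).toAffine.Point := finite_point_baseChange_of_twist K V W h2 hC
  set VK := V.baseChange K with hVK
  have hshaK : VK.ShaFinite := shaFinite_baseChange_of_twist K V W h2 hC hfinV hfinW
  -- the three odd-part identities
  have hTam := padicValRat_modifiedTamagawaProduct_baseChange_eq_of_semistable K V W p h2 hdodd hdsq hC
    hp2 hS h₀
  have hSha : padicValNat p VK.shaOrder = padicValNat p V.shaOrder + padicValNat p W.shaOrder :=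
    V.padicValNat_shaOrder_baseChange_quadratic_of_odd K h2 hC (C' := 1) (one_smul _ _) hshaK p hp2
  obtain ⟨θ, c, hθ, hc⟩ := Quadratic.exists_sq_eq_algebraMap (F := ℚ) (K := K) h2
  obtain ⟨q, hq, hd⟩ := NumberField.exists_discr_eq_mul_sq h2 hθ hc
  have hMW : padicValNat p (Nat.card VK.toAffine.Point) =
      padicValNat p (Nat.card V.toAffine.Point) + padicValNat p (Nat.card W.toAffine.Point) :=
    V.padicValNat_natCard_point_baseChange_quadratic_of_odd h2 hθ hc hq hd ⟨C, hC⟩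
      ⟨(1 : VariableChange K), one_smul _ _⟩ p hp2
  -- nonvanishing of all factors
  have hu : |(C.u : ℚ)| ≠ 0 := abs_ne_zero.mpr (C.u).ne_zero
  have hcV : (V.tamagawaProduct : ℚ) ≠ 0 := by exact_mod_cast V.tamagawaProduct_pos'.ne'
  have hcW : (W.tamagawaProduct : ℚ) ≠ 0 := by exact_mod_cast W.tamagawaProduct_pos'.ne'
  have hSV : (V.shaOrder : ℚ) ≠ 0 := by exact_mod_cast (V.shaOrder_pos hfinV).ne'
  have hSW : (W.shaOrder : ℚ) ≠ 0 := by exact_mod_cast (W.shaOrder_pos hfinW).ne'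
  have hSK : (VK.shaOrder : ℚ) ≠ 0 := by exact_mod_cast (VK.shaOrder_pos hshaK).ne'
  have hNV : ((Nat.card V.toAffine.Point : ℕ) : ℚ) ≠ 0 := by exact_mod_cast Nat.card_pos.ne'
  have hNW : ((Nat.card W.toAffine.Point : ℕ) : ℚ) ≠ 0 := by exact_mod_cast Nat.card_pos.ne'
  have hNK : ((Nat.card VK.toAffine.Point : ℕ) : ℚ) ≠ 0 := by exact_mod_cast Nat.card_pos.ne'
  have hn : ((V.baseChange ℝ).numRealComponents : ℚ) ≠ 0 := by
    exact_mod_cast (V.baseChange ℝ).numRealComponents_pos.ne'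
  have hM : VK.modifiedTamagawaProduct ≠ 0 := modifiedTamagawaProduct_ne_zero VK
  have hnv : padicValRat p ((V.baseChange ℝ).numRealComponents : ℚ) = 0 :=
    padicValRat_numRealComponents_eq_zero V p hp2
  rw [hVK] at hM hSK hNK hSha hMW
  rw [padicValRat.mul hu (mul_ne_zero hcV hcW), padicValRat.mul hcV hcW] at hTam
  rw [padicValRat.mul (mul_ne_zero (mul_ne_zero hM hSK) (pow_ne_zero 2 hNV)) (pow_ne_zero 2 hNW),
    padicValRat.mul (mul_ne_zero hM hSK) (pow_ne_zero 2 hNV), padicValRat.mul hM hSK,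
    padicValRat.mul (mul_ne_zero (mul_ne_zero (mul_ne_zero (mul_ne_zero (mul_ne_zero hn hu) hSV)
      hSW) hcV) hcW) (pow_ne_zero 2 hNK),
    padicValRat.mul (mul_ne_zero (mul_ne_zero (mul_ne_zero (mul_ne_zero hn hu) hSV) hSW) hcV) hcW,
    padicValRat.mul (mul_ne_zero (mul_ne_zero (mul_ne_zero hn hu) hSV) hSW) hcV,
    padicValRat.mul (mul_ne_zero (mul_ne_zero hn hu) hSV) hSW,
    padicValRat.mul (mul_ne_zero hn hu) hSV, padicValRat.mul hn hu]
  simp only [padicValRat.pow, padicValRat.of_nat, hnv, hTam, hSha, hMW]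
  push_cast
  ring

/-- **The rank-`(0,0)` valuation identity from the per-row certificate `Squarefree N_V`** (both `hS`
and `h₀` of `…_of_semistable` discharged by FILE 1 §3). [cite: Silverman1994, IV.10.2]
[cite: Milne1972ArithmeticAV, §1 Thm. 1 and §2 (through DokchitserDokchitserAnnals2010, §2.1, proof of Thm. 8)] -/
theorem padicVal_card_identity_baseChange_of_squarefree (h2 : Module.finrank ℚ K = 2)
    (hdodd : Odd (NumberField.discr K)) (hdsq : Squarefree (NumberField.discr K))
    {C : VariableChange ℚ} (hC : C • V.quadraticTwist (NumberField.discr K : ℚ) = W) (hp2 : p ≠ 2)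
    (hN : Squarefree (V.conductorNorm ℤ))
    [Finite V.toAffine.Point] [Finite W.toAffine.Point] (hfinV : V.ShaFinite) (hfinW : W.ShaFinite) :
    padicValRat p ((V.baseChange K).modifiedTamagawaProduct * (V.baseChange K).shaOrder *
        (Nat.card V.toAffine.Point) ^ 2 * (Nat.card W.toAffine.Point) ^ 2 : ℚ) =
      padicValRat p ((V.baseChange ℝ).numRealComponents * |(C.u : ℚ)| * V.shaOrder * W.shaOrder *
        V.tamagawaProduct * W.tamagawaProduct * (Nat.card (V.baseChange K).toAffine.Point) ^ 2 : ℚ) :=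
  padicVal_card_identity_baseChange_of_semistable K V W p h2 hdodd hdsq hC hp2
    (population_of_squarefree_conductorNorm K V W hN)
    (good_or_mult_atPrime_of_squarefree_conductorNorm V hN p) hfinV hfinW

end CardIdentity

/-! ## §2 Any rank: torsion orders in place of the Mordell–Weil orders -/

section AnyRank

variable (K : Type) [Field K] [NumberField K]
  (V : WeierstrassCurve ℚ) [V.IsElliptic] [V.IsGloballyMinimal]
  (W : WeierstrassCurve ℚ) [W.IsElliptic] [W.IsGloballyMinimal] (p : ℕ) [hp : Fact p.Prime]

omit [V.IsGloballyMinimal] [W.IsGloballyMinimal] in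
/-- **`v_p #Ш(V_K) = v_p #Ш(V) + v_p #Ш(W)` for odd `p`, ANY rank** (`[K:ℚ] = 2`, `W = C • V^{(d_K)}`,
`Ш(V)` and `Ш(W)` finite — hence `Ш(V_K)` finite, `shaFinite_baseChange_of_twist`): the order
form of `Ш(V_K)[p^∞] ≅ Ш(V)[p^∞] ⊕ Ш(W)[p^∞]` (tree
`card_primaryComponent_sha_baseChange_quadratic_of_odd_of_finite`) through `#A[p^∞] = p^{v_p #A}`.
[cite: JetchevSkinnerWan2017, §7.4.1 (arXiv:1512.06894 p. 30)]
[cite: DokchitserDokchitserAnnals2010, Lemma 4.14 (proof) and §2.1 (proof of Thm. 8)] -/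
theorem padicValNat_shaOrder_baseChange_of_twist (h2 : Module.finrank ℚ K = 2)
    {C : VariableChange ℚ} (hC : C • V.quadraticTwist (NumberField.discr K : ℚ) = W) (hp2 : p ≠ 2)
    (hfinV : V.ShaFinite) (hfinW : W.ShaFinite) :
    padicValNat p (V.baseChange K).shaOrder = padicValNat p V.shaOrder + padicValNat p W.shaOrder := by
  haveI : (V.baseChange K).IsElliptic := by rw [baseChange]; infer_instance
  haveI : Finite V.sha := hfinV
  haveI : Finite W.sha := hfinW
  haveI : Finite (V.baseChange K).sha := shaFinite_baseChange_of_twist K V W h2 hC hfinV hfinW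
  haveI : Finite (AddCommGroup.primaryComponent V.sha p) := Finite.of_injective _ Subtype.val_injective
  haveI : Finite (AddCommGroup.primaryComponent W.sha p) := Finite.of_injective _ Subtype.val_injective
  exact padicValNat_natCard_eq_add_of_primaryComponent p
    (card_primaryComponent_sha_baseChange_quadratic_of_odd_of_finite V K h2 W ⟨C, hC⟩ (V.baseChange K)
      ⟨1, one_smul _ _⟩ p hp2)

/-- **THE `p`-ADIC VALUATION OF MILNE'S QUOTIENT IDENTITY ON S₁, CANONICAL-MODEL CURRENCY, ANY RANK.**
For `V/ℚ` globally minimal, `K` quadratic with `d_K` odd squarefree, `W = C • V^{(d_K)}` globally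
minimal, the population hypothesis `hS` of row T-MIL-ODD, an odd prime `p` at which `V` is good or
multiplicative, and `Ш(V)`, `Ш(W)` finite:
`v_p C(V⊗K) + v_p #Ш(V_K) + 2 v_p #V(ℚ)_tors + 2 v_p #W(ℚ)_tors =
 v_p|u_C| + v_p #Ш(V) + v_p #Ш(W) + v_p ∏c(V) + v_p ∏c(W) + 2 v_p #V(K)_tors` —
Tamagawa–unit part FILE 1's `padicValRat_modifiedTamagawaProduct_baseChange_eq_of_semistable`, `Ш` part
`padicValNat_shaOrder_baseChange_of_twist`, torsion part additive-p1's
`padicValNat_torsionOrder_baseChange_quadratic_anyRank`. This is the second conjunct of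
`XGordRankZeroOneCyclotomicThreePrep.padicVal_card_identity_rankZeroOne` (torsion order = order for the
finite `W(ℚ)`, `torsionOrder_eq_natCard_of_finite`) with Milne's `hWR` and the index hypothesis `hm2`
GONE: on S₁ no Mordell–Weil basis or index enters (the transport shapes `…rankOneZero/OneOne` keep a
term `2·ord_p m`; matching them needs `p ∤ m`, not proved here).
[cite: Milne1972ArithmeticAV, §1 Thm. 1 and §2 (through DokchitserDokchitserAnnals2010, §2.1, proof of Thm. 8)]
[cite: DokchitserDokchitserAnnals2010, Lemma 4.14 (proof)] [cite: SilvermanAEC2009, Exercise 10.16] -/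
theorem padicVal_card_identity_baseChange_anyRank_of_semistable (h2 : Module.finrank ℚ K = 2)
    (hdodd : Odd (NumberField.discr K)) (hdsq : Squarefree (NumberField.discr K))
    {C : VariableChange ℚ} (hC : C • V.quadraticTwist (NumberField.discr K : ℚ) = W) (hp2 : p ≠ 2)
    (hS : ∀ v : HeightOneSpectrum (𝓞 ℚ), V.HasGoodReductionAt v ∨ V.HasMultiplicativeReductionAt v ∨
      (((primesEquiv v : ℕ) : ℤ) ∣ NumberField.discr K ∧ W.HasMultiplicativeReductionAt v))
    (h₀ : V.HasGoodReductionAtPrime p ∨ V.HasMultiplicativeReductionAtPrime p)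
    (hfinV : V.ShaFinite) (hfinW : W.ShaFinite) :
    padicValRat p (V.baseChange K).modifiedTamagawaProduct + padicValNat p (V.baseChange K).shaOrder +
        2 * padicValNat p V.torsionOrder + 2 * padicValNat p W.torsionOrder =
      padicValRat p |(C.u : ℚ)| + padicValNat p V.shaOrder + padicValNat p W.shaOrder +
        padicValNat p V.tamagawaProduct + padicValNat p W.tamagawaProduct +
        2 * padicValNat p (V.baseChange K).torsionOrder := by
  have hTam := padicValRat_modifiedTamagawaProduct_baseChange_eq_of_semistable K V W p h2 hdodd hdsq hC
    hp2 hS h₀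
  have hu : |(C.u : ℚ)| ≠ 0 := abs_ne_zero.mpr (C.u).ne_zero
  have hcV : (V.tamagawaProduct : ℚ) ≠ 0 := by exact_mod_cast V.tamagawaProduct_pos'.ne'
  have hcW : (W.tamagawaProduct : ℚ) ≠ 0 := by exact_mod_cast W.tamagawaProduct_pos'.ne'
  rw [padicValRat.mul hu (mul_ne_zero hcV hcW), padicValRat.mul hcV hcW, padicValRat.of_nat,
    padicValRat.of_nat] at hTam
  have hSha := padicValNat_shaOrder_baseChange_of_twist K V W p h2 hC hp2 hfinV hfinW
  obtain ⟨θ, c, hθ, hc⟩ := Quadratic.exists_sq_eq_algebraMap (F := ℚ) (K := K) h2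
  obtain ⟨q, hq, hd⟩ := NumberField.exists_discr_eq_mul_sq h2 hθ hc
  have hTor := padicValNat_torsionOrder_baseChange_quadratic_anyRank V K h2 hθ hc hq hd W ⟨C, hC⟩ p hp2
  rw [hTam, hSha, hTor]
  push_cast
  ring

/-- **The any-rank valuation identity from the per-row certificate `Squarefree N_V`** (both `hS` and
`h₀` of `…_anyRank_of_semistable` discharged by FILE 1 §3). [cite: Silverman1994, IV.10.2]
[cite: Milne1972ArithmeticAV, §1 Thm. 1 and §2 (through DokchitserDokchitserAnnals2010, §2.1, proof of Thm. 8)] -/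
theorem padicVal_card_identity_baseChange_anyRank_of_squarefree (h2 : Module.finrank ℚ K = 2)
    (hdodd : Odd (NumberField.discr K)) (hdsq : Squarefree (NumberField.discr K))
    {C : VariableChange ℚ} (hC : C • V.quadraticTwist (NumberField.discr K : ℚ) = W) (hp2 : p ≠ 2)
    (hN : Squarefree (V.conductorNorm ℤ)) (hfinV : V.ShaFinite) (hfinW : W.ShaFinite) :
    padicValRat p (V.baseChange K).modifiedTamagawaProduct + padicValNat p (V.baseChange K).shaOrder +
        2 * padicValNat p V.torsionOrder + 2 * padicValNat p W.torsionOrder =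
      padicValRat p |(C.u : ℚ)| + padicValNat p V.shaOrder + padicValNat p W.shaOrder +
        padicValNat p V.tamagawaProduct + padicValNat p W.tamagawaProduct +
        2 * padicValNat p (V.baseChange K).torsionOrder :=
  padicVal_card_identity_baseChange_anyRank_of_semistable K V W p h2 hdodd hdsq hC hp2
    (population_of_squarefree_conductorNorm K V W hN)
    (good_or_mult_atPrime_of_squarefree_conductorNorm V hN p) hfinV hfinW

end AnyRank

end Summit.BirchSwinnertonDyer.Rank1Residual.Additive

end
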